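import Summits.QuantumAdvantage.QuantumAdvantage.Theorems.WalkTwoStepLocalEngineCore

/-!
# (G♯) local engine — part 2/3 — §3 per-class composition `walkHardFTwoStep_of`, §4 flip invariance and `farHeavy_of_farLocal`, §5 the selection-function form (G♯)

VERBATIM split (for the 400-line rule) of planner qa-qnc0-p2 g24's checked skeleton `HOME/qa-qnc0-p2/line24/LocalEngine.lean`
(sha16 `7aa61edea42d6c70`, 1013 lines, farm rc 0 / 0 sorry / 0 warnings; authored AND proved by the planner seat; landed by
qn-prover-3 g15, ask P2-24b, `--supports stmt-QuantumAdvantage-23121` = rung (G♯) `OddPrimeWalk.TwoStepFreeRungFive`) into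
`WalkTwoStepLocalEngine{Core,Regimes,Glue}.lean` (+ `WalkTwoStepOddRow.lean`); only the file boundaries, the per-file preambles,
these header lines and one-line docstrings on the planner's undocumented auxiliary lemmas (lint) are new.
WHAT THIS IS: the PROVED glue of the three-regime plan (double count of discordant corner flips, pigeonhole on popular split
positions, flip invariance, `FarLocal → FarHeavy`, per-class composition, pinned parts and `SparsePinned → DensePinned → NearRegime`,
`twoStepFreeRungFive_of : FarLocal 5 → SparsePinned 5 → DensePinned 5 → <item 23121 signature>`), with the three regime lemmas
`FarLocal`, `SparsePinned`, `DensePinned` as OPEN `def … : Prop` (route-posited statements, not Literature facts; plans in their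
docstrings and in HOME/qa-qnc0-p2/ROUND-24.md §1ter).  WHAT THIS IS NOT: no proof of the three regime lemmas, hence no proof of
(G♯) yet; nothing about `LinSel`/R5; separation NOT moved.
-/

namespace Summit.QuantumAdvantage.AdviceFreeQNC0.LocalEngine

open Finset Classical
open Summit.QuantumAdvantage.AdviceFreeQNC0.Coset21.RungG (classOf)

/-! ### §3 Composition (kernel-checked) -/

/-- `#active ≤ n + 1`. -/
theorem activeCount_le {p n : ℕ} (S : TwoStep p n) (w : ZMod p) : activeCount S w ≤ n + 1 := by
  unfold activeCount
  exact le_trans (Finset.card_filter_le _ _) (by simp)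

/-- Auxiliary `walkHardFTwoStep_of` of the (G♯) local engine (planner qa-qnc0-p2 g24, `LocalEngine.lean`, verbatim; part 2). -/
theorem walkHardFTwoStep_of (p : ℕ) [Fact p.Prime] (hR1 : FarHeavy p) (hR2 : NearRegime p) :
    WalkHardFTwoStep p := by
  haveI : NeZero p := ⟨(Fact.out : p.Prime).ne_zero⟩
  obtain ⟨d₀, hR1⟩ := hR1
  obtain ⟨φ, hφ, θ₂, hθ₂, n₂, hR2⟩ := hR2 d₀
  -- M := a co-observer threshold with (n+1)/(M+1) ≤ φ n / 2
  obtain ⟨M, hM⟩ : ∃ M : ℕ, 4 / φ < M := exists_nat_gt _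
  obtain ⟨c₁, hc₁, n₁, hR1⟩ := hR1 M
  set θ₀ : ℝ := max θ₂ (1 - c₁ * φ / 4) with hθ₀
  have hcφ : 0 < c₁ * φ := mul_pos hc₁ hφ
  have hθ₀1 : θ₀ < 1 := max_lt hθ₂ (by linarith)
  have hθ₀2 : θ₂ ≤ θ₀ := le_max_left _ _
  have hθ₀c : 1 - c₁ * φ / 4 ≤ θ₀ := le_max_right _ _
  have hM0 : (0 : ℝ) < (M : ℝ) + 1 := by positivity
  refine ⟨θ₀, hθ₀1, max (max n₁ n₂) 1, fun n hn c S => ?_⟩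
  have hn₁ : n₁ ≤ n := le_trans (le_trans (le_max_left _ _) (le_max_left _ _)) hn
  have hn₂ : n₂ ≤ n := le_trans (le_trans (le_max_right _ _) (le_max_left _ _)) hn
  have hn1 : 1 ≤ n := le_trans (le_max_right _ _) hn
  -- fiberwise decomposition over the endpoint class
  have hwinN : (univ.filter fun u : Fin n → Bool => ringWinU c S.y u = true).card
      = ∑ w : ZMod p, (winIn c S w).card :=
    Finset.card_eq_sum_card_fiberwise (f := fun u : Fin n → Bool => ((wt u : ℕ) : ZMod p))
      (fun _ _ => Finset.mem_univ _)
  have hclsN : (univ : Finset (Fin n → Bool)).card = ∑ w : ZMod p, (classOf p w : Finset (Fin n → Bool)).card :=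
    Finset.card_eq_sum_card_fiberwise (f := fun u : Fin n → Bool => ((wt u : ℕ) : ZMod p))
      (fun _ _ => Finset.mem_univ _)
  have h2n : ((univ : Finset (Fin n → Bool)).card : ℝ) = (2 : ℝ) ^ n := by
    rw [Finset.card_univ, Fintype.card_fun, Fintype.card_bool, Fintype.card_fin]
    push_cast
    rfl
  have hwin : ((univ.filter fun u : Fin n → Bool => ringWinU c S.y u = true).card : ℝ)
      = ∑ w : ZMod p, ((winIn c S w).card : ℝ) := by exact_mod_cast hwinN
  have hcls : ∑ w : ZMod p, ((classOf p w : Finset (Fin n → Bool)).card : ℝ) = (2 : ℝ) ^ n := by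
    rw [← h2n]; exact_mod_cast hclsN.symm
  -- popular positions: pop·(M+1) ≤ n+1
  have hpopN : (popCount S M : ℝ) * ((M : ℝ) + 1) ≤ (n : ℝ) + 1 := by
    exact_mod_cast popCount_mul_le S M
  -- per-class bound: win_w ≤ θ₀ · cls_w
  have hper : ∀ w : ZMod p, ((winIn c S w).card : ℝ) ≤ θ₀ * ((classOf p w : Finset (Fin n → Bool)).card : ℝ) := by
    intro w
    have hc0 : (0 : ℝ) ≤ ((classOf p w : Finset (Fin n → Bool)).card : ℝ) := Nat.cast_nonneg _
    have hwle : ((winIn c S w).card : ℝ) ≤ ((classOf p w : Finset (Fin n → Bool)).card : ℝ) := by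
      have hsub : winIn c S w ⊆ classOf p w := by
        intro u hu
        simp only [winIn, Coset21.RungG.classOf, Finset.mem_filter, Finset.mem_univ, true_and] at hu ⊢
        exact hu.2
      exact_mod_cast Finset.card_le_card hsub
    by_cases hfar : (farCount S d₀ : ℝ) < φ * (n : ℝ)
    · -- R2': the near regime
      have h := hR2 n hn₂ c S w hfar
      exact le_trans h (mul_le_mul_of_nonneg_right hθ₀2 hc0)
    · -- R1: act·losers ≥ c₁ (far − pop) cls ≥ c₁ (φ n/2) cls, act ≤ n+1
      push Not at hfar
      have h := hR1 n hn₁ c S w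
      have hn1' : (1 : ℝ) ≤ (n : ℝ) := by exact_mod_cast hn1
      have hpop : (popCount S M : ℝ) ≤ φ * (n : ℝ) / 2 := by
        -- pop (M+1) ≤ n+1 ≤ 2n and 4/φ < M ⇒ pop ≤ 2n/(M+1) < 2n φ/4
        have hM' : 4 < φ * ((M : ℝ) + 1) := by
          have h4 : 4 < (M : ℝ) * φ := by
            have := hM; rwa [div_lt_iff₀ hφ] at this
          nlinarith
        by_contra hcon
        push Not at hcon
        have hpos : 0 < (popCount S M : ℝ) := lt_of_le_of_lt (by positivity) hcon
        have e1 : (popCount S M : ℝ) * 4 < (popCount S M : ℝ) * (φ * ((M : ℝ) + 1)) :=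
          mul_lt_mul_of_pos_left hM' hpos
        have e2 : (popCount S M : ℝ) * ((M : ℝ) + 1) * φ ≤ ((n : ℝ) + 1) * φ :=
          mul_le_mul_of_nonneg_right hpopN hφ.le
        have e3 : φ * (n : ℝ) / 2 * 4 < (popCount S M : ℝ) * 4 := mul_lt_mul_of_pos_right hcon (by norm_num)
        have r1 : (popCount S M : ℝ) * (φ * ((M : ℝ) + 1)) = (popCount S M : ℝ) * ((M : ℝ) + 1) * φ := by ring
        rw [r1] at e1
        nlinarith
      have hfp : φ * (n : ℝ) / 2 ≤ (farCount S d₀ : ℝ) - (popCount S M : ℝ) := by linarith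
      have hact : (activeCount S w : ℝ) ≤ (n : ℝ) + 1 := by exact_mod_cast activeCount_le S w
      -- c₁ (φ n / 2) cls ≤ act (cls − win) ≤ (n+1)(cls − win)
      have h' : c₁ * (φ * (n : ℝ) / 2) * ((classOf p w : Finset (Fin n → Bool)).card : ℝ)
          ≤ ((n : ℝ) + 1) * (((classOf p w : Finset (Fin n → Bool)).card : ℝ) - ((winIn c S w).card : ℝ)) := by
        have h1 := mul_le_mul_of_nonneg_left hfp (le_of_lt hc₁)
        have h2 := mul_le_mul_of_nonneg_right h1 hc0
        have h3 : (activeCount S w : ℝ) * (((classOf p w : Finset (Fin n → Bool)).card : ℝ) - ((winIn c S w).card : ℝ))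
            ≤ ((n : ℝ) + 1) * (((classOf p w : Finset (Fin n → Bool)).card : ℝ) - ((winIn c S w).card : ℝ)) :=
          mul_le_mul_of_nonneg_right hact (by linarith)
        exact le_trans h2 (le_trans h h3)
      -- n ≥ (n+1)/2, so c₁ φ /4 · cls · (n+1) ≤ c₁ φ n /2 · cls
      have h'' : ((n : ℝ) + 1) * (c₁ * φ / 4 * ((classOf p w : Finset (Fin n → Bool)).card : ℝ))
          ≤ ((n : ℝ) + 1) * (((classOf p w : Finset (Fin n → Bool)).card : ℝ) - ((winIn c S w).card : ℝ)) := by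
        refine le_trans ?_ h'
        have hcc : 0 ≤ c₁ * φ * ((classOf p w : Finset (Fin n → Bool)).card : ℝ) := by positivity
        nlinarith
      have hn0 : (0 : ℝ) < (n : ℝ) + 1 := by positivity
      have h3 : c₁ * φ / 4 * ((classOf p w : Finset (Fin n → Bool)).card : ℝ)
          ≤ ((classOf p w : Finset (Fin n → Bool)).card : ℝ) - ((winIn c S w).card : ℝ) :=
        le_of_mul_le_mul_left h'' hn0
      have e : (1 - c₁ * φ / 4) * ((classOf p w : Finset (Fin n → Bool)).card : ℝ)
          = ((classOf p w : Finset (Fin n → Bool)).card : ℝ) - c₁ * φ / 4 * ((classOf p w : Finset (Fin n → Bool)).card : ℝ) := by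
        ring
      have hθcls' : (1 - c₁ * φ / 4) * ((classOf p w : Finset (Fin n → Bool)).card : ℝ)
          ≤ θ₀ * ((classOf p w : Finset (Fin n → Bool)).card : ℝ) := mul_le_mul_of_nonneg_right hθ₀c hc0
      rw [e] at hθcls'
      linarith
  calc ((univ.filter fun u : Fin n → Bool => ringWinU c S.y u = true).card : ℝ)
      = ∑ w : ZMod p, ((winIn c S w).card : ℝ) := hwin
    _ ≤ ∑ w : ZMod p, θ₀ * ((classOf p w : Finset (Fin n → Bool)).card : ℝ) :=
        Finset.sum_le_sum fun w _ => hper w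
    _ = θ₀ * (2 : ℝ) ^ n := by rw [← Finset.mul_sum, hcls]

/-! ### §4 R1 from the local lemma: flips at unobserved times are invisible; `farHeavy_of_farLocal` -/

section Flip

variable {n : ℕ}

/-- the swap of `τ-1, τ` preserves `i < g` for every `g ≠ τ`. -/
theorem swap_val_lt_iff {τ : ℕ} (h : 1 ≤ τ ∧ τ < n) {g : ℕ} (hg : g ≠ τ) (i : Fin n) :
    ((Equiv.swap (⟨τ - 1, by omega⟩ : Fin n) ⟨τ, h.2⟩) i).val < g ↔ i.val < g := by
  rcases eq_or_ne i ⟨τ - 1, by omega⟩ with h1 | h1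
  · subst h1
    rw [Equiv.swap_apply_left]
    show τ < g ↔ τ - 1 < g
    omega
  · rcases eq_or_ne i ⟨τ, h.2⟩ with h2 | h2
    · subst h2
      rw [Equiv.swap_apply_right]
      show τ - 1 < g ↔ τ < g
      omega
    · rw [Equiv.swap_apply_of_ne_of_ne h1 h2]

/-- Auxiliary `sum_ite_comp_perm` of the (G♯) local engine (planner qa-qnc0-p2 g24, `LocalEngine.lean`, verbatim; part 2). -/
theorem sum_ite_comp_perm {M : Type*} [AddCommMonoid M] (u : Fin n → Bool) (e : Equiv.Perm (Fin n))
    (c : Fin n → M) (hc : ∀ i, c (e i) = c i) :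
    (∑ i, if u (e i) = true then c i else 0) = ∑ i, if u i = true then c i else 0 := by
  have h : ∀ i, (if u (e i) = true then c i else 0) = (if u (e i) = true then c (e i) else 0) :=
    fun i => by rw [hc i]
  rw [Finset.sum_congr rfl (fun i _ => h i)]
  exact Equiv.sum_comp e (fun j => if u j = true then c j else 0)

/-- Auxiliary `wt_cornerFlip` of the (G♯) local engine (planner qa-qnc0-p2 g24, `LocalEngine.lean`, verbatim; part 2). -/
theorem wt_cornerFlip (τ : ℕ) (u : Fin n → Bool) : wt (cornerFlip n τ u) = wt u := by
  unfold cornerFlip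
  split_ifs with h
  · unfold wt
    rw [Finset.card_filter, Finset.card_filter]
    exact sum_ite_comp_perm u _ (fun _ => 1) (fun _ => rfl)
  · rfl

/-- Auxiliary `wtPrefix_cornerFlip` of the (G♯) local engine (planner qa-qnc0-p2 g24, `LocalEngine.lean`, verbatim; part 2). -/
theorem wtPrefix_cornerFlip (τ : ℕ) (u : Fin n → Bool) {g : ℕ} (hg : g ≠ τ) :
    wtPrefix (cornerFlip n τ u) g = wtPrefix u g := by
  unfold cornerFlip
  split_ifs with h
  · unfold wtPrefix
    rw [Finset.card_filter, Finset.card_filter]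
    have h1 : ∀ v : Fin n → Bool, (∑ i : Fin n, if (i.val < g ∧ v i = true) then 1 else 0)
        = ∑ i : Fin n, if v i = true then (if i.val < g then 1 else 0) else 0 := by
      intro v
      refine Finset.sum_congr rfl fun i _ => ?_
      by_cases hv : v i = true <;> by_cases hi : i.val < g <;> simp [hv, hi]
    rw [h1, h1]
    exact sum_ite_comp_perm u _ (fun i => if i.val < g then 1 else 0)
      (fun i => by simp only [swap_val_lt_iff h hg i])
  · rfl

/-- Auxiliary `form_cornerFlip` of the (G♯) local engine (planner qa-qnc0-p2 g24, `LocalEngine.lean`, verbatim; part 2). -/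
theorem form_cornerFlip {p : ℕ} (τ : ℕ) (u : Fin n → Bool) {s : ℕ} (hs : s ≠ τ) (a b : ZMod p) :
    (∑ i : Fin n, if cornerFlip n τ u i = true then (if i.val < s then a else b) else 0)
      = ∑ i : Fin n, if u i = true then (if i.val < s then a else b) else 0 := by
  unfold cornerFlip
  split_ifs with h
  · exact sum_ite_comp_perm u _ (fun i => if i.val < s then a else b)
      (fun i => by simp only [swap_val_lt_iff h hs i])
  · rfl

/-- Auxiliary `y_cornerFlip` of the (G♯) local engine (planner qa-qnc0-p2 g24, `LocalEngine.lean`, verbatim; part 2). -/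
theorem y_cornerFlip {p : ℕ} (S : TwoStep p n) (τ : ℕ) (u : Fin n → Bool) (g : Fin (n + 1))
    (hs : S.s g ≠ τ) : S.y g (cornerFlip n τ u) = S.y g u := by
  unfold TwoStep.y
  rw [form_cornerFlip τ u hs]

/-- Auxiliary `walkExp_cornerFlip` of the (G♯) local engine (planner qa-qnc0-p2 g24, `LocalEngine.lean`, verbatim; part 2). -/
theorem walkExp_cornerFlip (τ : ℕ) (u : Fin n → Bool) {g : ℕ} (hg : g ≠ τ) :
    walkExp (cornerFlip n τ u) g = walkExp u g := by
  unfold walkExp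
  rw [wt_cornerFlip, wtPrefix_cornerFlip τ u hg]

/-- flips at a time observed by NO active cut do not change the outcome inside the class. -/
theorem ringWinU_cornerFlip {p : ℕ} (c : ℕ) (S : TwoStep p n) (w : ZMod p) (τ : ℕ) (u : Fin n → Bool)
    (hu : ((wt u : ℕ) : ZMod p) = w)
    (hτ : ∀ g : Fin (n + 1), Active S w g → g.val ≠ τ ∧ S.s g ≠ τ) :
    ringWinU c S.y (cornerFlip n τ u) = ringWinU c S.y u := by
  have hset : (univ.filter fun g : Fin (n + 1) =>
        S.y g (cornerFlip n τ u) = true ∧ (c + g.val + walkExp (cornerFlip n τ u) g.val) % 3 ≠ 0)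
      = (univ.filter fun g : Fin (n + 1) => S.y g u = true ∧ (c + g.val + walkExp u g.val) % 3 ≠ 0) := by
    apply Finset.filter_congr
    intro g _
    by_cases hA : Active S w g
    · obtain ⟨h1, h2⟩ := hτ g hA
      rw [y_cornerFlip S τ u g h2, walkExp_cornerFlip τ u h1]
    · have hfalse : ∀ v : Fin n → Bool, ((wt v : ℕ) : ZMod p) = w → S.y g v = false := by
        intro v hv
        by_contra hne
        exact hA ⟨v, hv, by simpa using hne⟩
      have hu' : ((wt (cornerFlip n τ u) : ℕ) : ZMod p) = w := by rw [wt_cornerFlip]; exact hu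
      rw [hfalse _ hu', hfalse _ hu]
      simp
  unfold ringWinU
  rw [hset]

/-- a fixed input is discordant only at times observed by ACTIVE cuts: at most `2·#active` of them. -/
theorem discordantTimes_card_le {p : ℕ} (c : ℕ) (S : TwoStep p n) (w : ZMod p) (v : Fin n → Bool)
    (hv : ((wt v : ℕ) : ZMod p) = w) (T : Finset ℕ) :
    (T.filter fun τ => ringWinU c S.y (cornerFlip n τ v) ≠ ringWinU c S.y v).card ≤ 2 * activeCount S w := by
  set Act := (univ : Finset (Fin (n + 1))).filter fun g => Active S w g with hAct
  have hsub : (T.filter fun τ => ringWinU c S.y (cornerFlip n τ v) ≠ ringWinU c S.y v)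
      ⊆ Act.image (fun g => g.val) ∪ Act.image (fun g => S.s g) := by
    intro τ hτ
    rw [Finset.mem_filter] at hτ
    by_contra hnot
    rw [Finset.mem_union, not_or] at hnot
    apply hτ.2
    apply ringWinU_cornerFlip c S w τ v hv
    intro g hg
    have hgA : g ∈ Act := by simp [hAct, hg]
    exact ⟨fun h => hnot.1 (Finset.mem_image.mpr ⟨g, hgA, h⟩),
      fun h => hnot.2 (Finset.mem_image.mpr ⟨g, hgA, h⟩)⟩
  calc (T.filter fun τ => ringWinU c S.y (cornerFlip n τ v) ≠ ringWinU c S.y v).card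
      ≤ (Act.image (fun g => g.val) ∪ Act.image (fun g => S.s g)).card := Finset.card_le_card hsub
    _ ≤ (Act.image (fun g => g.val)).card + (Act.image (fun g => S.s g)).card := Finset.card_union_le _ _
    _ ≤ Act.card + Act.card := Nat.add_le_add Finset.card_image_le Finset.card_image_le
    _ = 2 * activeCount S w := by rw [hAct, two_mul]; rfl

end Flip

/-- **R1 = local lemma + double count**: `FarLocal p → FarHeavy p` (with `c₁ = κ(d₀,M)/4`). -/
theorem farHeavy_of_farLocal (p : ℕ) [Fact p.Prime] (h : FarLocal p) : FarHeavy p := by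
  obtain ⟨d₀, hloc⟩ := h
  refine ⟨d₀, fun M => ?_⟩
  obtain ⟨κ, hκ, n₀, hloc⟩ := hloc M
  refine ⟨κ / 4, by positivity, n₀, fun n hn c S w => ?_⟩
  set U : Finset (Fin n → Bool) := classOf p w with hU
  set f : (Fin n → Bool) → Bool := fun u => ringWinU c S.y u with hf
  set FarSet : Finset (Fin (n + 1)) := univ.filter fun g => Far S d₀ g ∧ coSplit S g.val ≤ M with hFS
  set T : Finset ℕ := FarSet.image (fun g => g.val) with hT
  have hinj : Set.InjOn (fun g : Fin (n + 1) => g.val) FarSet := fun a _ b _ hab => Fin.ext hab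
  have hU0 : (0 : ℝ) ≤ (U.card : ℝ) := Nat.cast_nonneg _
  -- unpopular far cuts: #FarSet ≥ #far − #popular
  have hFS_ge : (farCount S d₀ : ℝ) - (popCount S M : ℝ) ≤ (FarSet.card : ℝ) := by
    have hsub : (univ.filter fun g : Fin (n + 1) => Far S d₀ g)
        ⊆ FarSet ∪ (univ.filter fun g : Fin (n + 1) => M < coSplit S g.val) := by
      intro g hg
      rw [Finset.mem_filter] at hg
      rw [Finset.mem_union, hFS, Finset.mem_filter, Finset.mem_filter]
      by_cases hM : coSplit S g.val ≤ M
      · exact Or.inl ⟨Finset.mem_univ _, hg.2, hM⟩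
      · exact Or.inr ⟨Finset.mem_univ _, by omega⟩
    have h1 := le_trans (Finset.card_le_card hsub) (Finset.card_union_le _ _)
    have h2 : (farCount S d₀ : ℝ) ≤ (FarSet.card : ℝ) + (popCount S M : ℝ) := by
      have : farCount S d₀ ≤ FarSet.card + popCount S M := h1
      exact_mod_cast this
    linarith
  -- lower bound from the local lemma
  have hlow : κ * (FarSet.card : ℝ) * (U.card : ℝ)
      ≤ ∑ τ ∈ T, ((U.filter fun u => f u ≠ f (cornerFlip n τ u)).card : ℝ) := by
    rw [hT, Finset.sum_image hinj]
    calc κ * (FarSet.card : ℝ) * (U.card : ℝ) = ∑ _g ∈ FarSet, κ * (U.card : ℝ) := by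
          rw [Finset.sum_const, nsmul_eq_mul]; ring
      _ ≤ ∑ g ∈ FarSet, ((U.filter fun u => f u ≠ f (cornerFlip n g.val u)).card : ℝ) := by
          apply Finset.sum_le_sum
          intro g hg
          have hg' : Far S d₀ g ∧ coSplit S g.val ≤ M := by
            have := hg; rw [hFS, Finset.mem_filter] at this; exact this.2
          have := hloc n hn c S w g hg'.1 hg'.2
          rw [hU, hf]; exact this
  -- upper bound by the double count with D = 2·#active
  have hup : (∑ τ ∈ T, (U.filter fun u => f u ≠ f (cornerFlip n τ u)).card)
      ≤ 2 * (2 * activeCount S w) * (U.filter fun v => f v = false).card := by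
    apply sum_discordant_le_on f (fun τ u => cornerFlip n τ u) (fun τ u => cornerFlip_cornerFlip n τ u) U ?_ T
    · intro v hv hfv
      have hv' : ((wt v : ℕ) : ZMod p) = w := by
        rw [hU] at hv; unfold Coset21.RungG.classOf at hv; rw [Finset.mem_filter] at hv; exact hv.2
      exact discordantTimes_card_le c S w v hv' T
    · intro τ u hu
      rw [hU] at hu ⊢; unfold Coset21.RungG.classOf at hu ⊢
      rw [Finset.mem_filter] at hu ⊢
      exact ⟨Finset.mem_univ _, by rw [wt_cornerFlip]; exact hu.2⟩
  have hupR : (∑ τ ∈ T, ((U.filter fun u => f u ≠ f (cornerFlip n τ u)).card : ℝ))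
      ≤ 2 * (2 * (activeCount S w : ℝ)) * ((U.filter fun v => f v = false).card : ℝ) := by
    exact_mod_cast hup
  -- losers in the class = |class| − |winIn|
  have hlosers : ((U.filter fun v => f v = false).card : ℝ) = (U.card : ℝ) - ((winIn c S w).card : ℝ) := by
    have h1 : (U.filter fun v => f v = false).card + (U.filter fun v => f v = true).card = U.card := by
      rw [← Finset.card_union_of_disjoint]
      · congr 1
        ext u
        simp only [Finset.mem_union, Finset.mem_filter]
        cases f u <;> simp
      · rw [Finset.disjoint_left]
        intro u h1 h2
        simp only [Finset.mem_filter] at h1 h2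
        rw [h1.2] at h2
        exact Bool.false_ne_true h2.2
    have h2 : (U.filter fun v => f v = true) = winIn c S w := by
      ext u
      rw [hU, hf]; unfold winIn Coset21.RungG.classOf
      simp only [Finset.mem_filter, Finset.mem_univ, true_and]
      tauto
    rw [h2] at h1
    have : ((U.filter fun v => f v = false).card : ℝ) + ((winIn c S w).card : ℝ) = (U.card : ℝ) := by
      exact_mod_cast h1
    linarith
  rw [hlosers] at hupR
  have hchain := le_trans hlow hupR
  have hmono : κ * ((farCount S d₀ : ℝ) - (popCount S M : ℝ)) * (U.card : ℝ) ≤ κ * (FarSet.card : ℝ) * (U.card : ℝ) := by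
    have := mul_le_mul_of_nonneg_left hFS_ge (le_of_lt hκ)
    exact mul_le_mul_of_nonneg_right this hU0
  nlinarith [hchain, hmono]

/-! ### §5 Link to the selection-function form (G♯) of `Sketch24` (restated verbatim) -/

/-- verbatim `Sketch24.TwoStepSel`: each cut is SOME two-step free-split linear test. -/
def TwoStepSel (p : ℕ) {n : ℕ} (y : Fin (n + 1) → (Fin n → Bool) → Bool) : Prop :=
  ∀ g, ∃ s : ℕ, ∃ α β r : ZMod p, ∀ u,
    y g u = decide ((univ.sum fun i : Fin n => if u i then (if i.val < s then α else β) else 0) = r)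

/-- verbatim `Sketch24.WalkHardFTwoStepFree` = (G♯). -/
def WalkHardFTwoStepFree (p : ℕ) : Prop :=
  ∃ θ : ℝ, θ < 1 ∧ ∃ n₀ : ℕ, ∀ n ≥ n₀, ∀ c : ℕ,
    ∀ y : Fin (n + 1) → (Fin n → Bool) → Bool, TwoStepSel p y →
      ((univ.filter fun u : Fin n → Bool => ringWinU c y u = true).card : ℝ) ≤ θ * (2 : ℝ) ^ n

/-- Auxiliary `twoStepSel_y` of the (G♯) local engine (planner qa-qnc0-p2 g24, `LocalEngine.lean`, verbatim; part 2). -/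
theorem twoStepSel_y {p n : ℕ} (S : TwoStep p n) : TwoStepSel p S.y :=
  fun g => ⟨S.s g, S.α g, S.β g, S.r g, fun _ => rfl⟩

/-- Auxiliary `walkHardFTwoStepFree_of_twoStep` of the (G♯) local engine (planner qa-qnc0-p2 g24, `LocalEngine.lean`, verbatim; part 2). -/
theorem walkHardFTwoStepFree_of_twoStep {p : ℕ} (h : WalkHardFTwoStep p) : WalkHardFTwoStepFree p := by
  obtain ⟨θ, hθ, n₀, hn⟩ := h
  refine ⟨θ, hθ, n₀, fun n hn' c y hy => ?_⟩
  choose s α β r hy' using hy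
  have : y = TwoStep.y ⟨s, α, β, r⟩ := by
    funext g u
    rw [hy' g u]
    rfl
  rw [this]
  exact hn n hn' c _

/-- Auxiliary `walkHardFTwoStep_of_free` of the (G♯) local engine (planner qa-qnc0-p2 g24, `LocalEngine.lean`, verbatim; part 2). -/
theorem walkHardFTwoStep_of_free {p : ℕ} (h : WalkHardFTwoStepFree p) : WalkHardFTwoStep p := by
  obtain ⟨θ, hθ, n₀, hn⟩ := h
  exact ⟨θ, hθ, n₀, fun n hn' c S => hn n hn' c S.y (twoStepSel_y S)⟩

/-- **Skeleton of (G♯)**: the two regime statements give the rung; R1 is the local lemma plus the PROVED double count. -/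
theorem walkHardFTwoStepFree_of_regimes (p : ℕ) [Fact p.Prime]
    (h₁ : FarLocal p) (h₂ : NearRegime p) : WalkHardFTwoStepFree p :=
  walkHardFTwoStepFree_of_twoStep (walkHardFTwoStep_of p (farHeavy_of_farLocal p h₁) h₂)


end Summit.QuantumAdvantage.AdviceFreeQNC0.LocalEngine
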